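import Literature.Probability.Process.LevyCharacterisationVec
import Literature.Probability.Process.BrownianVecLaw
import Mathlib.Probability.Independence.CharacteristicFunction
import Mathlib.Probability.Process.FiniteDimensionalLaws
import Mathlib.Analysis.InnerProductSpace.ProdL2
import HarnessLib

/-!
# Lévy's characterisation of `n`-dimensional Brownian motion, II: the `𝓕`-Markov property; `IsBrownianVec`

Topic `Probability/Process`; theorems only.  Continuation of `LevyCharacterisationVec.lean` (same hypotheses:
for every unit `θ`, `θ·M` and `(θ·M)² - t` are local martingales of a raw filtration `𝓕`; here `M` is moreover
`𝓕`-adapted).  From the base-time-independent constant of `exists_const_integral_mul_cexp_shift_sum`: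

* `indepFun_indicator_shiftMarginal`, `indep_comap_shiftMarginal` — for `A ∈ 𝓕 s` and finitely many shifts
  `u ∈ J`, `𝟙_A` is independent of `(M_{s+u} - M_s)_{u∈J}` (joint characteristic function factorises; Mathlib
  `indepFun_iff_charFun_prod` on `ℝ × PiLp 2`), i.e. the σ-algebra of the `J`-marginal is independent of `𝓕 s`;
* ★ `indep_comap_vecShift` — **the `𝓕`-Markov property**: the whole shifted process `u ↦ M_{s+u} - M_s` is
  independent of `𝓕 s` (monotone supremum over `J`, Mathlib `indep_iSup_of_monotone`); hence
  `indepFun_vecShift_vecPast` (independence from the past `(M_r)_{r ≤ s}`);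
* `map_restrict_vecShift_eq`, `map_vecShift_eq_map_vecPath` — the shifted process has the finite-dimensional
  laws, hence the path law, of `M` (Mathlib `map_eq_iff_forall_finset_map_restrict_eq`);
* ★ `isBrownianVec_of_forall_isLocalMartingale_dot` — with continuous paths and `M 0 = 0` for every `ω`, `M`
  is an `n`-dimensional Brownian motion in the sense of the tree's hypothesis structure `IsBrownianVec M P`;
* ★ `isBrownianVec_of_martingale`, `indep_comap_vecShift_of_martingale`, `hasLaw_sub_gaussVec_of_martingale` —
  the same from coordinate MARTINGALES `Mⁱ` with `Mⁱ Mʲ - δ_{ij} t` martingales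
  (`forall_isLocalMartingale_dot_of_martingale`: `θ·M = Σ θᵢMⁱ`, `(θ·M)² - t = Σᵢⱼ θᵢθⱼ(MⁱMʲ - δ_{ij}t)`).

Typical use (rotated / re-assembled noises `∫ R dB` with `R` orthogonal and adapted: reflection, mirror and
synchronous couplings): the coordinates are Itô integrals, hence martingales with the right brackets, and this
file turns them into a Brownian motion OF THE COMMON FILTRATION `𝓕` (not merely of its own filtration).

## References

* J.-F. Le Gall, *Brownian Motion, Martingales, and Stochastic Calculus*, GTM 274 (2016), Thm 5.12.
* D. Revuz, M. Yor, *Continuous Martingales and Brownian Motion* (3rd ed., 1999), Ch. IV, Thm (3.6).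
-/

set_option autoImplicit false

noncomputable section

open MeasureTheory ProbabilityTheory Filter Topology Complex Finset
open scoped NNReal ENNReal BigOperators

namespace Literature.Probability.Process

variable {Ω : Type*} {m : MeasurableSpace Ω} {P : Measure Ω} {n : ℕ}
  {M : ℝ≥0 → Ω → (Fin n → ℝ)} {𝓕 : Filtration ℝ≥0 m}

section LineHypotheses

variable
  (hM : ∀ θ : Fin n → ℝ, ∑ i, θ i ^ 2 = 1 →
    RandomPlanarGeometry.IsLocalMartingale (fun t ω ↦ ∑ i, θ i * M t ω i) 𝓕 P ∧
    RandomPlanarGeometry.IsLocalMartingale (fun t ω ↦ (∑ i, θ i * M t ω i) ^ 2 - (t : ℝ)) 𝓕 P)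
include hM

variable [IsProbabilityMeasure P]

/-! ### Independence of the shifted process from `𝓕 s` -/

section Adapted

variable (hadapt : ∀ t, Measurable[𝓕 t] (M t))
include hadapt

omit [IsProbabilityMeasure P] hM in
/-- `M_t` is measurable (for an adapted `M`). [folklore] -/
private theorem measurable_of_forall_measurable_filtration (t : ℝ≥0) : Measurable (M t) := (hadapt t).mono (𝓕.le t) le_rfl

omit [IsProbabilityMeasure P] hM in
/-- The finite-dimensional marginal `(M_{s+u} - M_s)_{u ∈ J}` of the shifted process, read in the
Euclidean space `PiLp 2` over `J × Fin n`, is measurable. [folklore] -/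
private theorem measurable_shiftMarginal (s : ℝ≥0) (J : Finset ℝ≥0) :
    Measurable fun ω ↦ WithLp.toLp 2 (fun p : ↥J × Fin n ↦ M (s + p.1) ω p.2 - M s ω p.2) := by
  refine (WithLp.measurable_toLp 2 _).comp (measurable_pi_lambda _ fun p ↦ ?_)
  exact ((measurable_pi_apply p.2).comp (measurable_of_forall_measurable_filtration hadapt _)).sub
    ((measurable_pi_apply p.2).comp (measurable_of_forall_measurable_filtration hadapt _))

/-- **An indicator of the past is independent of finitely many shifted values**: for `A ∈ 𝓕 s` and a
finite set of shifts `J`, `𝟙_A` is independent of `(M_{s+u} - M_s)_{u ∈ J}` (Mathlib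
`indepFun_iff_charFun_prod`: the joint characteristic function factorises by
`exists_const_integral_mul_cexp_shift_sum` applied to the weight `e^{ia𝟙_A}`).
[cite: Legall2016, Thm 5.12 (proof)] -/
theorem indepFun_indicator_shiftMarginal (h0 : ∀ᵐ ω ∂P, M 0 ω = 0) (hc : ∀ᵐ ω ∂P, Continuous (M · ω))
    (s : ℝ≥0) (J : Finset ℝ≥0) {A : Set Ω} (hA : MeasurableSet[𝓕 s] A) :
    IndepFun (A.indicator fun _ ↦ (1 : ℝ))
      (fun ω ↦ WithLp.toLp 2 (fun p : ↥J × Fin n ↦ M (s + p.1) ω p.2 - M s ω p.2)) P := by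
  classical
  have hA' : MeasurableSet A := 𝓕.le s A hA
  have hX : Measurable (A.indicator fun _ ↦ (1 : ℝ)) := measurable_const.indicator hA'
  have hY := measurable_shiftMarginal hadapt s J
  rw [indepFun_iff_charFun_prod hX.aemeasurable hY.aemeasurable]
  intro ξ
  obtain ⟨⟨a, ζ⟩⟩ := ξ
  -- frequencies: `a` against the indicator, `η` (read off `ζ`) against the shifted values
  set η : ℝ≥0 → Fin n → ℝ := fun u i ↦ if h : u ∈ J then (WithLp.ofLp ζ) (⟨u, h⟩, i) else 0 with hη
  obtain ⟨c, hcc⟩ := exists_const_integral_mul_cexp_shift_sum hM h0 hc J η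
  -- the pairing with `ζ` is the frequency-weighted sum over `J`
  have hpair : ∀ ω, (inner ℝ (WithLp.toLp 2 (fun p : ↥J × Fin n ↦ M (s + p.1) ω p.2 - M s ω p.2)) ζ : ℝ) =
      ∑ u ∈ J, ∑ i, η u i * (M (s + u) ω i - M s ω i) := by
    intro ω
    rw [PiLp.inner_apply, Fintype.sum_prod_type, ← Finset.sum_coe_sort J]
    refine Finset.sum_congr rfl fun u _ ↦ Finset.sum_congr rfl fun i _ ↦ ?_
    simp [hη, u.2, mul_comm]
  have hind : ∀ ω, (inner ℝ (A.indicator (fun _ ↦ (1 : ℝ)) ω) a : ℝ) = a * A.indicator (fun _ ↦ (1 : ℝ)) ω := by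
    intro ω
    by_cases hω : ω ∈ A <;> simp [hω]
  -- the weight `e^{ia 𝟙_A}`
  set G : Ω → ℂ := fun ω ↦ cexp (I * (a * A.indicator (fun _ ↦ (1 : ℝ)) ω : ℝ)) with hG
  have hGm : AEStronglyMeasurable[𝓕 s] G P := by
    refine (by fun_prop : Continuous fun x : ℝ ↦ cexp (I * x)).comp_aestronglyMeasurable ?_
    exact ((stronglyMeasurable_const (b := (1 : ℝ))).indicator hA).aestronglyMeasurable.const_mul a
  have hG1 : ∀ᵐ ω ∂P, ‖G ω‖ ≤ 1 := ae_of_all _ fun ω ↦ by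
    rw [hG, Complex.norm_exp_I_mul_ofReal]
  have hjoint := hcc s G hGm hG1
  have hone := hcc s (fun _ ↦ 1) stronglyMeasurable_const.aestronglyMeasurable (ae_of_all _ fun ω ↦ by simp)
  simp only [one_mul, integral_const, probReal_univ, one_smul, mul_one] at hone
  -- both sides explicitly
  have hlhs : charFun (P.map fun ω ↦ WithLp.toLp 2 (A.indicator (fun _ ↦ (1 : ℝ)) ω,
      WithLp.toLp 2 (fun p : ↥J × Fin n ↦ M (s + p.1) ω p.2 - M s ω p.2))) (WithLp.toLp 2 (a, ζ)) =
      c * ∫ ω, G ω ∂P := by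
    rw [charFun_apply, integral_map (by fun_prop) (by fun_prop), ← hjoint]
    refine integral_congr_ae (ae_of_all _ fun ω ↦ ?_)
    dsimp only
    rw [WithLp.prod_inner_apply]
    dsimp only
    rw [hpair ω, hind ω, hG, ← Complex.exp_add]
    congr 1
    push_cast
    ring
  have hr1 : charFun (P.map (A.indicator fun _ ↦ (1 : ℝ))) a = ∫ ω, G ω ∂P := by
    rw [charFun_apply, integral_map hX.aemeasurable (by fun_prop)]
    refine integral_congr_ae (ae_of_all _ fun ω ↦ ?_)
    dsimp only
    rw [hind ω, hG, mul_comm]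
  have hr2 : charFun (P.map fun ω ↦ WithLp.toLp 2 (fun p : ↥J × Fin n ↦ M (s + p.1) ω p.2 - M s ω p.2)) ζ = c := by
    rw [charFun_apply, integral_map hY.aemeasurable (by fun_prop), ← hone]
    refine integral_congr_ae (ae_of_all _ fun ω ↦ ?_)
    dsimp only
    rw [hpair ω, mul_comm]
  dsimp only
  rw [hlhs, hr1, hr2, mul_comm]

/-- **Finitely many shifted values are independent of `𝓕 s`** (σ-algebra form: the σ-algebra generated
by `(M_{s+u} - M_s)_{u ∈ J}` is independent of `𝓕 s`; test `𝓕 s` on its sets `A` via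
`indepFun_indicator_shiftMarginal`). [cite: Legall2016, Thm 5.12 (proof)] -/
theorem indep_comap_shiftMarginal (h0 : ∀ᵐ ω ∂P, M 0 ω = 0) (hc : ∀ᵐ ω ∂P, Continuous (M · ω))
    (s : ℝ≥0) (J : Finset ℝ≥0) :
    Indep (MeasurableSpace.comap
      (fun ω ↦ WithLp.toLp 2 (fun p : ↥J × Fin n ↦ M (s + p.1) ω p.2 - M s ω p.2)) inferInstance)
      (𝓕 s) P := by
  rw [Indep_iff]
  intro B A hB hA
  obtain ⟨C, hC, rfl⟩ := MeasurableSpace.measurableSet_comap.1 hB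
  have h := (indepFun_indicator_shiftMarginal hM hadapt h0 hc s J hA).measure_inter_preimage_eq_mul
    (s := {1}) (t := C) (measurableSet_singleton 1) hC
  have hpre : (A.indicator fun _ ↦ (1 : ℝ)) ⁻¹' {1} = A := by
    ext ω
    by_cases hω : ω ∈ A <;> simp [hω]
  rw [hpre] at h
  rw [Set.inter_comm, h, mul_comm]

/-- **The `𝓕`-Markov property**: the whole shifted process `u ↦ M_{s+u} - M_s` is independent of `𝓕 s`
(the σ-algebra it generates is the directed supremum over finite sets of shifts `J` of σ-algebras each
≤ the one generated by the `J`-marginal; Mathlib `indep_iSup_of_monotone`).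
[cite: Legall2016, Thm 5.12 (proof)] -/
theorem indep_comap_vecShift (h0 : ∀ᵐ ω ∂P, M 0 ω = 0) (hc : ∀ᵐ ω ∂P, Continuous (M · ω)) (s : ℝ≥0) :
    Indep (MeasurableSpace.comap (vecShift M s) inferInstance) (𝓕 s) P := by
  classical
  -- the σ-algebras of the finite-dimensional marginals
  set mJ : Finset ℝ≥0 → MeasurableSpace Ω := fun J ↦ MeasurableSpace.comap
    (fun ω ↦ WithLp.toLp 2 (fun p : ↥J × Fin n ↦ M (s + p.1) ω p.2 - M s ω p.2)) inferInstance with hmJ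
  have hle : ∀ J, mJ J ≤ m := fun J ↦ (measurable_shiftMarginal hadapt s J).comap_le
  have hmono : Monotone mJ := by
    intro J₁ J₂ h12
    -- the `J₁`-marginal is a measurable function of the `J₂`-marginal
    let π : PiLp 2 (fun _ : ↥J₂ × Fin n ↦ ℝ) → PiLp 2 (fun _ : ↥J₁ × Fin n ↦ ℝ) := fun g ↦
      WithLp.toLp 2 (fun p : ↥J₁ × Fin n ↦ (WithLp.ofLp g) (⟨p.1, h12 p.1.2⟩, p.2))
    have hπ : Measurable π := (WithLp.measurable_toLp 2 _).comp
      (measurable_pi_lambda _ fun p ↦ (measurable_pi_apply _).comp (WithLp.measurable_ofLp 2 _))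
    have hcomp : (fun ω ↦ WithLp.toLp 2 (fun p : ↥J₁ × Fin n ↦ M (s + p.1) ω p.2 - M s ω p.2)) =
        π ∘ fun ω ↦ WithLp.toLp 2 (fun p : ↥J₂ × Fin n ↦ M (s + p.1) ω p.2 - M s ω p.2) := by
      funext ω; rfl
    change MeasurableSpace.comap _ _ ≤ MeasurableSpace.comap _ _
    rw [hcomp, ← MeasurableSpace.comap_comp]
    exact MeasurableSpace.comap_mono hπ.comap_le
  have hsup : Indep (⨆ J, mJ J) (𝓕 s) P :=
    indep_iSup_of_monotone (fun J ↦ indep_comap_shiftMarginal hM hadapt h0 hc s J) hle (𝓕.le s) hmono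
  refine indep_of_indep_of_le_left hsup ?_
  -- `σ(vecShift) ≤ ⨆_J σ(J-marginal)`: each coordinate `(M_{s+u} - M_s)_i` is a function of the `{u}`-marginal
  rw [show (inferInstance : MeasurableSpace (ℝ≥0 → Fin n → ℝ)) = MeasurableSpace.pi from rfl,
    MeasurableSpace.pi, MeasurableSpace.comap_iSup]
  refine iSup_le fun u ↦ ?_
  rw [MeasurableSpace.comap_comp]
  have hfun : ((fun f : ℝ≥0 → Fin n → ℝ ↦ f u) ∘ vecShift M s) =
      (fun g : PiLp 2 (fun _ : ↥({u} : Finset ℝ≥0) × Fin n ↦ ℝ) ↦ fun i : Fin n ↦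
          (WithLp.ofLp g) (⟨u, Finset.mem_singleton_self u⟩, i)) ∘
        fun ω ↦ WithLp.toLp 2 (fun p : ↥({u} : Finset ℝ≥0) × Fin n ↦ M (s + p.1) ω p.2 - M s ω p.2) := by
    funext ω; rfl
  rw [hfun, ← MeasurableSpace.comap_comp]
  refine le_trans (MeasurableSpace.comap_mono ?_) (le_iSup mJ {u})
  exact (measurable_pi_lambda _ fun i ↦ (measurable_pi_apply _).comp (WithLp.measurable_ofLp 2 _)).comap_le

/-- **Weak Markov property in the form of `IsBrownianVec`**: the shifted process is independent of the
past `(M_r)_{r ≤ s}` (which is `𝓕 s`-measurable for an adapted `M`). [cite: Legall2016, Thm 5.12 (proof)] -/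
theorem indepFun_vecShift_vecPast (h0 : ∀ᵐ ω ∂P, M 0 ω = 0) (hc : ∀ᵐ ω ∂P, Continuous (M · ω))
    (s : ℝ≥0) : IndepFun (vecShift M s) (vecPast M s) P := by
  rw [IndepFun_iff_Indep]
  refine indep_of_indep_of_le_right (indep_comap_vecShift hM hadapt h0 hc s) ?_
  have h : Measurable[𝓕 s] (vecPast M s) :=
    @measurable_pi_lambda _ _ _ (𝓕 s) _ _ fun r ↦ (hadapt r).mono (𝓕.mono r.2) le_rfl
  exact h.comap_le

/-! ### The shifted process has the path law of `M` -/

/-- The finite-dimensional laws of the shifted process `u ↦ M_{s+u} - M_s` and of `M` agree (both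
characteristic functions are the constant of `exists_const_integral_mul_cexp_shift_sum`, at base times
`s` and `0`; `M_0 = 0` a.s.). [cite: Legall2016, Thm 5.12 (proof)] -/
theorem map_restrict_vecShift_eq (h0 : ∀ᵐ ω ∂P, M 0 ω = 0) (hc : ∀ᵐ ω ∂P, Continuous (M · ω))
    (s : ℝ≥0) (J : Finset ℝ≥0) :
    P.map (fun ω ↦ J.restrict (vecShift M s ω)) = P.map (fun ω ↦ J.restrict (vecPath M ω)) := by
  classical
  -- transport to the Euclidean space over `J × Fin n`
  let φ : (↥J → Fin n → ℝ) → PiLp 2 (fun _ : ↥J × Fin n ↦ ℝ) := fun f ↦ WithLp.toLp 2 (fun p ↦ f p.1 p.2)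
  let ψ : PiLp 2 (fun _ : ↥J × Fin n ↦ ℝ) → (↥J → Fin n → ℝ) := fun g u i ↦ (WithLp.ofLp g) (u, i)
  have hφ : Measurable φ := (WithLp.measurable_toLp 2 _).comp
    (measurable_pi_lambda _ fun p ↦ (measurable_pi_apply p.2).comp (measurable_pi_apply p.1))
  have hψ : Measurable ψ := measurable_pi_lambda _ fun u ↦ measurable_pi_lambda _ fun i ↦
    (measurable_pi_apply _).comp (WithLp.measurable_ofLp 2 _)
  have hψφ : ψ ∘ φ = id := funext fun f ↦ rfl
  have hinj : ∀ μ ν : Measure (↥J → Fin n → ℝ), μ.map φ = ν.map φ → μ = ν := by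
    intro μ ν h
    have h' := congrArg (fun ρ ↦ Measure.map ψ ρ) h
    rwa [Measure.map_map hψ hφ, Measure.map_map hψ hφ, hψφ, Measure.map_id, Measure.map_id] at h'
  have hm1 : Measurable fun ω ↦ J.restrict (vecShift M s ω) :=
    (Finset.measurable_restrict _).comp (measurable_pi_lambda _ fun u ↦
      (measurable_of_forall_measurable_filtration hadapt _).sub (measurable_of_forall_measurable_filtration hadapt _))
  have hm2 : Measurable fun ω ↦ J.restrict (vecPath M ω) :=
    (Finset.measurable_restrict _).comp (measurable_pi_lambda _ fun u ↦ measurable_of_forall_measurable_filtration hadapt _)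
  haveI : IsProbabilityMeasure (P.map fun ω ↦ J.restrict (vecShift M s ω)) :=
    Measure.isProbabilityMeasure_map hm1.aemeasurable
  haveI : IsProbabilityMeasure (P.map fun ω ↦ J.restrict (vecPath M ω)) :=
    Measure.isProbabilityMeasure_map hm2.aemeasurable
  haveI : IsProbabilityMeasure ((P.map fun ω ↦ J.restrict (vecShift M s ω)).map φ) :=
    Measure.isProbabilityMeasure_map hφ.aemeasurable
  haveI : IsProbabilityMeasure ((P.map fun ω ↦ J.restrict (vecPath M ω)).map φ) :=
    Measure.isProbabilityMeasure_map hφ.aemeasurable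
  refine hinj _ _ (Measure.ext_of_charFun (funext fun ζ ↦ ?_))
  rw [Measure.map_map hφ hm1, Measure.map_map hφ hm2, charFun_apply, charFun_apply,
    integral_map (hφ.comp hm1).aemeasurable (by fun_prop),
    integral_map (hφ.comp hm2).aemeasurable (by fun_prop)]
  set η : ℝ≥0 → Fin n → ℝ := fun u i ↦ if h : u ∈ J then (WithLp.ofLp ζ) (⟨u, h⟩, i) else 0 with hη
  have hpair1 : ∀ ω, (inner ℝ ((φ ∘ fun ω ↦ J.restrict (vecShift M s ω)) ω) ζ : ℝ) =
      ∑ u ∈ J, ∑ i, η u i * (M (s + u) ω i - M s ω i) := by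
    intro ω
    simp only [Function.comp_apply, φ]
    rw [PiLp.inner_apply, Fintype.sum_prod_type, ← Finset.sum_coe_sort J]
    refine Finset.sum_congr rfl fun u _ ↦ Finset.sum_congr rfl fun i _ ↦ ?_
    simp [hη, u.2, vecShift, mul_comm]
  have hpair2 : ∀ ω, (inner ℝ ((φ ∘ fun ω ↦ J.restrict (vecPath M ω)) ω) ζ : ℝ) =
      ∑ u ∈ J, ∑ i, η u i * M u ω i := by
    intro ω
    simp only [Function.comp_apply, φ]
    rw [PiLp.inner_apply, Fintype.sum_prod_type, ← Finset.sum_coe_sort J]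
    refine Finset.sum_congr rfl fun u _ ↦ Finset.sum_congr rfl fun i _ ↦ ?_
    simp [hη, u.2, vecPath, mul_comm]
  simp_rw [hpair1, hpair2]
  have e1 : ∀ ω, cexp ((∑ u ∈ J, ∑ i, η u i * (M (s + u) ω i - M s ω i) : ℝ) * I) =
      cexp (I * (∑ u ∈ J, ∑ i, η u i * (M (s + u) ω i - M s ω i) : ℝ)) := fun ω ↦ by rw [mul_comm]
  simp_rw [e1]
  rw [integral_cexp_shift_sum_eq_integral_cexp_shift_sum hM h0 hc J η s 0]
  refine integral_congr_ae ?_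
  filter_upwards [h0] with ω hω
  rw [mul_comm]
  congr 3
  refine Finset.sum_congr rfl fun u _ ↦ Finset.sum_congr rfl fun i _ ↦ ?_
  simp [hω]

/-- **The shifted process has the path law of `M`**: `law(u ↦ M_{s+u} - M_s) = law(M)` on
`(ℝ≥0 → ℝⁿ, ⊗ Borel)` (finite-dimensional laws agree, Mathlib `map_eq_iff_forall_finset_map_restrict_eq`).
[cite: Legall2016, Thm 5.12 (proof)] -/
theorem map_vecShift_eq_map_vecPath (h0 : ∀ᵐ ω ∂P, M 0 ω = 0) (hc : ∀ᵐ ω ∂P, Continuous (M · ω))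
    (s : ℝ≥0) : P.map (vecShift M s) = P.map (vecPath M) := by
  have h1 : AEMeasurable (fun ω ↦ fun u ↦ vecShift M s ω u) P :=
    (measurable_pi_lambda _ fun u ↦
      (measurable_of_forall_measurable_filtration hadapt _).sub (measurable_of_forall_measurable_filtration hadapt _)).aemeasurable
  have h2 : AEMeasurable (fun ω ↦ fun u ↦ vecPath M ω u) P :=
    (measurable_pi_lambda _ fun u ↦ measurable_of_forall_measurable_filtration hadapt _).aemeasurable
  exact (map_eq_iff_forall_finset_map_restrict_eq (X := fun u ω ↦ vecShift M s ω u)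
    (Y := fun u ω ↦ vecPath M ω u) h1 h2).2 (map_restrict_vecShift_eq hM hadapt h0 hc s)

/-! ### Packaging: `M` is an `n`-dimensional Brownian motion -/

/-- ★ **Lévy's characterisation of `n`-dimensional Brownian motion.** Let `M : ℝ≥0 → Ω → ℝⁿ` be adapted to
a filtration `𝓕` on a probability space, with continuous paths and `M 0 = 0` (every `ω`), such that for
every unit vector `θ` the processes `θ·M` and `(θ·M)² - t` are local martingales of `𝓕`.  Then `M` is an
`n`-dimensional Brownian motion: `IsBrownianVec M P` (measurable marginals, continuous paths, `M_0 = 0`,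
weak Markov property at deterministic times, Gaussian marginals `N(0, tI_n)`).
[cite: Legall2016, Thm 5.12] -/
theorem isBrownianVec_of_forall_isLocalMartingale_dot (h0 : ∀ ω, M 0 ω = 0)
    (hc : ∀ ω, Continuous (M · ω)) : IsBrownianVec M P where
  measurable t := measurable_of_forall_measurable_filtration hadapt t
  continuous_path := hc
  apply_zero := h0
  indep_shift s := indepFun_vecShift_vecPast hM hadapt (ae_of_all _ h0) (ae_of_all _ hc) s
  map_shift s := map_vecShift_eq_map_vecPath hM hadapt (ae_of_all _ h0) (ae_of_all _ hc) s
  map_apply t := (hasLaw_gaussVec hM (ae_of_all _ h0) (ae_of_all _ hc) t).map_eq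

end Adapted

end LineHypotheses

/-! ### From coordinate martingales with brackets `δ_{ij} t` -/

section Martingales

/-- Finite sums of martingales are martingales. [folklore] -/
private theorem martingale_finset_sum {ι : Type*} (s : Finset ι) {f : ι → ℝ≥0 → Ω → ℝ}
    (hf : ∀ k ∈ s, Martingale (f k) 𝓕 P) : Martingale (fun t ω ↦ ∑ k ∈ s, f k t ω) 𝓕 P := by
  classical
  induction s using Finset.induction_on with
  | empty =>
    simp only [Finset.sum_empty]
    exact martingale_zero ℝ 𝓕 P
  | insert a s ha ih =>
    simp_rw [Finset.sum_insert ha]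
    exact (hf a (Finset.mem_insert_self a s)).add (ih fun k hk ↦ hf k (Finset.mem_insert_of_mem hk))

/-- The coordinates of `M_t` being `𝓕 t`-strongly measurable, `M_t` is `𝓕 t`-measurable. [folklore] -/
private theorem measurable_of_martingale_apply (hMi : ∀ i, Martingale (fun t ω ↦ M t ω i) 𝓕 P) (t : ℝ≥0) :
    Measurable[𝓕 t] (M t) :=
  @measurable_pi_lambda _ _ _ (𝓕 t) _ _ fun i ↦ ((hMi i).stronglyMeasurable t).measurable

/-- **Coordinate martingales with brackets `⟨Mⁱ, Mʲ⟩_t = δ_{ij} t` satisfy the line hypotheses**: if every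
`Mⁱ` is a martingale and every `Mⁱ Mʲ - δ_{ij} t` is a martingale, then for every unit `θ` the processes
`θ·M = Σ θᵢ Mⁱ` and `(θ·M)² - t = Σᵢⱼ θᵢθⱼ (MⁱMʲ - δ_{ij} t)` are (local) martingales (the reduction of the
`d`-dimensional statement to exponential martingales along lines in Le Gall's proof). [cite: Legall2016, Thm 5.12 (proof)] -/
theorem forall_isLocalMartingale_dot_of_martingale (hMi : ∀ i, Martingale (fun t ω ↦ M t ω i) 𝓕 P)
    (hMik : ∀ i k, Martingale (fun t ω ↦ M t ω i * M t ω k - if i = k then (t : ℝ) else 0) 𝓕 P)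
    (θ : Fin n → ℝ) (hθ : ∑ i, θ i ^ 2 = 1) :
    RandomPlanarGeometry.IsLocalMartingale (fun t ω ↦ ∑ i, θ i * M t ω i) 𝓕 P ∧
    RandomPlanarGeometry.IsLocalMartingale (fun t ω ↦ (∑ i, θ i * M t ω i) ^ 2 - (t : ℝ)) 𝓕 P := by
  refine ⟨(martingale_finset_sum Finset.univ fun i _ ↦ (hMi i).smul (θ i)).isLocalMartingale, ?_⟩
  have hsum : Martingale (fun t ω ↦ ∑ i, ∑ k, θ i * θ k * (M t ω i * M t ω k - if i = k then (t : ℝ) else 0))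
      𝓕 P :=
    martingale_finset_sum Finset.univ fun i _ ↦
      martingale_finset_sum Finset.univ fun k _ ↦ (hMik i k).smul (θ i * θ k)
  have heq : (fun t ω ↦ (∑ i, θ i * M t ω i) ^ 2 - (t : ℝ)) =
      fun t ω ↦ ∑ i, ∑ k, θ i * θ k * (M t ω i * M t ω k - if i = k then (t : ℝ) else 0) := by
    funext t ω
    have h1 : ∑ i, ∑ k, θ i * θ k * (M t ω i * M t ω k - if i = k then (t : ℝ) else 0) =
        (∑ i, ∑ k, θ i * M t ω i * (θ k * M t ω k)) - ∑ i, ∑ k, (if i = k then θ i * θ k * (t : ℝ) else 0) := by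
      rw [← Finset.sum_sub_distrib]
      refine Finset.sum_congr rfl fun i _ ↦ ?_
      rw [← Finset.sum_sub_distrib]
      refine Finset.sum_congr rfl fun k _ ↦ ?_
      split_ifs <;> ring
    rw [h1, ← Finset.sum_mul_sum, sq]
    congr 1
    simp_rw [Finset.sum_ite_eq, if_pos (Finset.mem_univ _)]
    rw [← Finset.sum_mul]
    simp_rw [← sq]
    rw [hθ, one_mul]
  rw [heq]
  exact hsum.isLocalMartingale

variable [IsProbabilityMeasure P]

/-- ★ **Lévy's characterisation, martingale form.** If the coordinates `Mⁱ` of a process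
`M : ℝ≥0 → Ω → ℝⁿ` with continuous paths and `M 0 = 0` are martingales of a filtration `𝓕` with
`Mⁱ Mʲ - δ_{ij} t` martingales (`⟨Mⁱ, Mʲ⟩_t = δ_{ij} t`), then `M` is an `n`-dimensional Brownian motion,
`IsBrownianVec M P`. [cite: Legall2016, Thm 5.12] -/
theorem isBrownianVec_of_martingale (hMi : ∀ i, Martingale (fun t ω ↦ M t ω i) 𝓕 P)
    (hMik : ∀ i k, Martingale (fun t ω ↦ M t ω i * M t ω k - if i = k then (t : ℝ) else 0) 𝓕 P)
    (h0 : ∀ ω, M 0 ω = 0) (hc : ∀ ω, Continuous (M · ω)) : IsBrownianVec M P :=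
  isBrownianVec_of_forall_isLocalMartingale_dot (forall_isLocalMartingale_dot_of_martingale hMi hMik)
    (measurable_of_martingale_apply hMi) h0 hc

/-- **`𝓕`-Markov property, martingale form**: under the hypotheses of `isBrownianVec_of_martingale`
(a.s. versions of `M 0 = 0` and continuity suffice) the shifted process `u ↦ M_{s+u} - M_s` is independent
of `𝓕 s` — `M` is an `𝓕`-Brownian motion, not merely a Brownian motion in its own filtration.
[cite: Legall2016, Thm 5.12] -/
theorem indep_comap_vecShift_of_martingale (hMi : ∀ i, Martingale (fun t ω ↦ M t ω i) 𝓕 P)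
    (hMik : ∀ i k, Martingale (fun t ω ↦ M t ω i * M t ω k - if i = k then (t : ℝ) else 0) 𝓕 P)
    (h0 : ∀ᵐ ω ∂P, M 0 ω = 0) (hc : ∀ᵐ ω ∂P, Continuous (M · ω)) (s : ℝ≥0) :
    Indep (MeasurableSpace.comap (vecShift M s) inferInstance) (𝓕 s) P :=
  indep_comap_vecShift (forall_isLocalMartingale_dot_of_martingale hMi hMik)
    (measurable_of_martingale_apply hMi) h0 hc s

/-- **Gaussian increments, martingale form**: `M_t - M_s ∼ N(0, (t-s)I_n)` for `s ≤ t`.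
[cite: Legall2016, Thm 5.12] -/
theorem hasLaw_sub_gaussVec_of_martingale (hMi : ∀ i, Martingale (fun t ω ↦ M t ω i) 𝓕 P)
    (hMik : ∀ i k, Martingale (fun t ω ↦ M t ω i * M t ω k - if i = k then (t : ℝ) else 0) 𝓕 P)
    (h0 : ∀ᵐ ω ∂P, M 0 ω = 0) (hc : ∀ᵐ ω ∂P, Continuous (M · ω)) {s t : ℝ≥0} (hst : s ≤ t) :
    HasLaw (fun ω ↦ M t ω - M s ω) (gaussVec n (t - s)) P :=
  hasLaw_sub_gaussVec (forall_isLocalMartingale_dot_of_martingale hMi hMik) h0 hc hst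

end Martingales


end Literature.Probability.Process

end
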